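import Literature.Computability.FineGrained.CliqueETH
import HarnessLib

/-!
# SETH ⇒ OV (fine-grained.S09): status of the cross-model fact and decomposition of the printed
theorem

Companion to `Literature.Computability.FineGrained.SETHHardness` for **fine-grained.S09**
(R. Williams, *A new algorithm for optimal 2-constraint satisfaction and its implications*,
TCS 348 (2005), §5.1; V. Vassilevska Williams, *On some fine-grained questions in algorithms and
complexity*, Proc. ICM 2018, §3, Thm. 3.1 "SETH implies the OV Conjecture") in its two readings:

* `ovConjectureDet_of_sethWordRAM : SETHWordRAM → OVConjectureDet` — hypothesis and conclusion in
  the one machine model of the sources, the word RAM with `O(log n)`-bit words (VVW ICM 2018, §2;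
  VVW IPEC 2015, §2); this is the printed theorem and the only reading vendored as a named fact
  (in the statement file);
* the cross-model implication `SETH → OVConjectureDet` — Wave0's multi-stack *Turing-machine*
  SETH (`KSATInExpTime`, `Turing.FinTM2`) as hypothesis, the *word-RAM* lower bound as
  conclusion. It was vendored in the statement file as the named fact `ovConjectureDet_of_seth`
  (the model-independence reading of SETH of OUTLINE D1) until 2026-08-14, when it was retired as
  *misstated* (verdict of its prove seat, re-verified: it is not the theorem in print, see the
  next section). In this file it survives only as an explicit proposition, in the bridge lemmas
  `ovConjectureDet_of_seth_of_bridge`, `ovConjectureDet_of_seth_iff` and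
  `ovConjectureDet_of_seth_of`, which pin down what separates it from print.

## Status of the cross-model implication `SETH → OVConjectureDet`

It is not the printed theorem and is not provable by the printed proof: contrapositively one must
turn a truly subquadratic *word-RAM* algorithm for OV (in every dimension `c log n`) into a
`2^{(1-ε')n} · poly(L)` *multi-stack Turing machine* for `k`-SAT (every `k`). The split-and-list
reduction produces the `k`-SAT algorithm in the model in which the OV algorithm runs; carrying it
over to Turing machines needs a simulation of random-access machines by multitape/multi-stack
machines, and the known simulations (Cook–Reckhow, JCSS 7 (1973), §2; in this tree
`Literature.Computability.Cryptography.WordRAM.ToTM2.runs_interp`, used for the ETH-granularity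
bridge of `CliqueETHTMBridge.lean`) have polynomial — essentially quadratic — overhead, which maps
`2^{(1-ε/2)n}` to `2^{(2-ε)n} > 2^n`. Running the OV algorithm on blocks of `s` vectors does not
help (`(N/s)² · s^{2-ε} · s^{a} = N² · s^{a-ε}` needs a simulation overhead `s^{a}` with `a < ε` for
the *given*, arbitrarily small, `ε`), and blocks must have `s ≥ N^{Ω(1)}` vectors for the dimension
`d = Θ(n)` to be `O(log s)`. A subpolynomial-overhead simulation of RAMs by multitape Turing
machines is not known, so `SETH → OVConjectureDet` is an open strengthening of Thm. 3.1 (the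
model-independence reading of SETH); `ovConjectureDet_of_seth_of_bridge` below records that it is
*exactly* the printed theorem plus the machine-model bridge `SETH → SETHWordRAM` (the converse
bridge `seth_of_sethWordRAM` is the easy direction, vendored in the statement file).

That the sources mean one machine model is explicit in the author's earlier survey
(V. Vassilevska Williams, IPEC 2015, §2: "Since we are focusing on exact running times, we need to
fix the model of computation. Here we assume that we are working with a Word RAM model with
`O(log n)` bit words"), which states SETH (Conj. 3: "for every `ε > 0` there exists an integer `k`
such that Satisfiability on `k`-CNF formulas on `n` variables cannot be solved in
`O(2^{(1-ε)n} poly n)` time") and the OV conjecture (Conj. 4) in that model and proves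
"`k`-SAT `≤_{2ⁿ, n²}` OV" (§4, Thm. 1) by sparsification followed by the split-and-list
construction — the architecture of the decomposition below. That the two machine-model readings
of SETH are genuinely different hypotheses as far as anyone knows is also stated in print:
K. Gajulapalli, A. Golovnev, S. King, S. Saraogi, *Online Orthogonal Vectors Revisited* (SODA 2026,
arXiv:2605.04798), §2.1, footnote to "On the choice of the computational model": "even for the
extremely well-studied SETH conjecture, there is no clear agreement on the computational model. In
particular, a `2^{n/2}` RAM algorithm for SAT would not necessarily imply a Turing machine solving
SAT in fewer than `2^n` steps. Therefore, such an algorithm would refute SETH stated for RAM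
algorithms but not the Turing machines version of SETH."

## Decomposition of the printed theorem `ovConjectureDet_of_sethWordRAM`

The printed proof (VVW ICM 2018, proof of Thm. 3.1; Williams 2005, §5.1) has two machine-level
ingredients, vendored here as named facts in the word-RAM model, and an assembly, proved here:

* `kSATInRAMTime_of_sparseKSATInRAMTime_serf` — the sparsification lemma of
  Impagliazzo–Paturi–Zane (JCSS 63 (2001), Thm. 1, Cor. 1, Cor. 2) as a SERF reduction on the word
  RAM *at SETH granularity*: for all `k` and `ε > 0` there is a density `C` such that an
  `O(2^{δ n})` word-RAM algorithm for the `k`-CNFs with at most `C · n` clauses gives an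
  `O(2^{(δ+ε) n})` one for all `k`-CNFs (the ETH-granularity form "every exponent from every
  exponent" is `kSATInRAMTime_of_sparseKSATInRAMTime` of `CliqueETH.lean`, too weak here);
* `sparseKSATInRAMTime_of_ov_subquadratic` — Williams' split-and-list reduction on the word RAM in
  the regime `d = c log N`: if OV with `d = c ⌊log₂ n⌋` is in deterministic time `O(n^{2-ε})` for
  every `c ≥ 1` (`0 < ε ≤ 1`), then for every `k`, every density `c'` and every `δ > 1 - ε/2` the
  sparse `k`-CNFs of density `c'` are decided in word-RAM time `O(2^{δ n})`;
* `ovConjectureDet_of_sethWordRAM_of` — **assembly (proved)**: the two facts imply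
  `ovConjectureDet_of_sethWordRAM` verbatim (given `ε`, shrink it below `1`, get sparse `k`-SAT at
  exponent `1 - 3ε/8` for every density, hence `k`-SAT at exponent `1 - ε/4` for every `k`,
  contradicting word-RAM SETH at `ε/4`).

What remains for `ovConjectureDet_of_sethWordRAM_holds`: the two word-RAM programs. For the
second, the toolkit of `CliqueETHReductionProgram.lean` applies verbatim (structured code
`SProg`, the logic `SProg.Achieves`, one emulated sub-run `SProg.withSubrun` of the hypothetical OV
program at its own word size); for the first, either a word-RAM implementation of the algorithm
`Reduce` (the multi-stack one is `sparsification_holds`, `SparsificationAlgorithm.lean`) or a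
constant-overhead simulation of `Turing.FinTM2` by word-RAM programs with `Θ(n)`-bit words (the
easy direction of the machine comparison, cf. `kSATInRAMTime_of_kSATInExpTime`).

## References

* R. Williams, *A new algorithm for optimal 2-constraint satisfaction and its implications*,
  Theoret. Comput. Sci. 348 (2005) 357–365, §5.1 (Theorem 5 of the author's version: cooperative
  subset queries in `Õ(f(d) k^{2-ε})` give CNF-SAT in `Õ(f(m) 2^{(1-ε/2)n})`; cited as Thm. 5.1 in
  `SETHHardness.lean`).
* V. Vassilevska Williams, *On some fine-grained questions in algorithms and complexity*,
  Proc. ICM 2018, Vol. 4, 3447–3487, §2 (word RAM), §3 (Hypotheses 1–2, Thm. 3.1).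
* V. Vassilevska Williams, *Hardness of easy problems: basing hardness on popular conjectures such
  as the Strong Exponential Time Hypothesis*, IPEC 2015, LIPIcs 43, §2 (model; Conj. 3 SETH,
  Conj. 4 OVC), §4 Thm. 1 (`k`-SAT `≤_{2ⁿ, n²}` OV).
* R. Impagliazzo, R. Paturi, F. Zane, *Which problems have strongly exponential complexity?*,
  J. Comput. Syst. Sci. 63 (2001) 512–530, Thm. 1, Cor. 1, Cor. 2.
* S. A. Cook, R. A. Reckhow, *Time bounded random access machines*, J. Comput. Syst. Sci. 7 (1973)
  354–375, §2.
* K. Gajulapalli, A. Golovnev, S. King, S. Saraogi, *Online Orthogonal Vectors Revisited*,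
  SODA 2026, arXiv:2605.04798, §2.1 (Definition 2.4 and the footnote on the computational model of
  SETH).
-/

namespace Literature.Computability.FineGrained

open Cryptography Cryptography.WordRAM

/-! ### The cross-model implication is the printed theorem plus the machine-model bridge -/

/-- The cross-model implication `SETH → OVConjectureDet` (Turing-machine SETH ⇒ word-RAM OV
hardness; until 2026-08-14 the named fact `ovConjectureDet_of_seth` of the statement file, retired
as misstated) follows from the printed word-RAM theorem `ovConjectureDet_of_sethWordRAM` together
with the machine-model bridge `SETH → SETHWordRAM` ("a `2^{(1-ε)n}`-time word-RAM algorithm for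
`k`-SAT yields a `2^{(1-ε')n} · poly(L)`-time multi-stack Turing machine"), which would require a
subpolynomial-overhead simulation of random-access machines by multitape Turing machines and is not
known (Cook–Reckhow, JCSS 7 (1973), §2 give polynomial overhead; see the module docstring). Recorded
to pin down exactly what separates the cross-model reading from the theorem in print.
[folklore] -/
theorem ovConjectureDet_of_seth_of_bridge (hbridge : SETH → SETHWordRAM)
    (h : ovConjectureDet_of_sethWordRAM) : SETH → OVConjectureDet :=
  fun hSETH => h (hbridge hSETH)

/-- Conversely, what the cross-model implication `SETH → OVConjectureDet` asserts beyond print is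
precisely a SETH-granularity transfer from the word RAM to Turing machines along the OV reduction:
it says that a truly subquadratic word-RAM algorithm for OV in every dimension `c log n` refutes
*Turing-machine* SETH. [folklore] -/
theorem ovConjectureDet_of_seth_iff :
    (SETH → OVConjectureDet) ↔ (¬ OVConjectureDet → ¬ SETH) :=
  ⟨fun h hov hS => hov (h hS), fun h hS => Classical.by_contradiction fun hov => h hov hS⟩

/-! ### The two machine-level ingredients of the printed proof, on the word RAM -/

/-- **Sparsification as a SERF reduction on the word RAM, at SETH granularity (named fact).** For
every `k` and every `ε > 0` there is a density `C = C(k, ε)` such that for every exponent `δ ≥ 0`: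
if the `k`-CNFs with at most `C · n` clauses (instances of `kSATProblem k`, `n = numVars`) are
decided on the deterministic word RAM in time `O(2^{δ n})` (`SparseKSATInRAMTime k C δ`), then all
of `k`-SAT is decided in time `O(2^{(δ + ε) n})` (`KSATInRAMTime k (δ + ε)`). Printed form
(Impagliazzo–Paturi–Zane, JCSS 63 (2001), Thm. 1 and Cor. 1): for all `ε > 0` and `k` there is `C`
and an algorithm writing any `k`-CNF on `n` variables as a disjunction of at most `2^{ε n}` `k`-CNFs
on the same variables with at most `C · n` clauses each, in time `poly(n) · 2^{ε n}`; hence (Cor. 2)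
`k`-SAT with parameter `n` SERF-reduces to `k`-SAT with parameter `m`. The reduction used here:
sparsify with `ε/2`, remove repeated clauses, pad each sub-formula (for `k ≥ 2`) with the
tautological clause `x_{n-1} ∨ ¬x_{n-1}` so that its own `numVars` is exactly `n` and its density at
most `C + 1` (for `k ≤ 1` decide directly in polynomial time), run the given sparse decider on each
of the `≤ 2^{ε n/2}` sub-formulas and accept iff one accepts; total time
`poly(n) · 2^{ε n/2} + 2^{ε n/2} · O(2^{δ n}) = O(2^{(δ+ε) n})` as `δ ≥ 0`. The machine model of the
source is unspecified ("algorithm"); this is the word-RAM reading at the granularity needed for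
SETH (the ETH-granularity reading is `kSATInRAMTime_of_sparseKSATInRAMTime`, the multi-stack
Turing-machine form of Thm. 1 / Cor. 1 is Wave0's `sparsification`, proved as
`sparsification_holds`). Its proof needs a word-RAM implementation of the algorithm `Reduce` of §2
(or a constant-overhead word-RAM simulation of the multi-stack sparsifier) and a driver with
relocated sub-runs. [cite: ImpagliazzoPaturiZaneJCSS2001, Thm. 1, Cor. 1 and Cor. 2] -/
def kSATInRAMTime_of_sparseKSATInRAMTime_serf : Prop :=
  ∀ (k : ℕ) (ε : ℝ), 0 < ε → ∃ C : ℕ, ∀ δ : ℝ, 0 ≤ δ →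
    SparseKSATInRAMTime k C δ → KSATInRAMTime k (δ + ε)

/-- **Williams' split-and-list reduction on the word RAM, in the regime `d = c log N` (named
fact).** If for some `0 < ε ≤ 1` and every `c ≥ 1` Orthogonal Vectors on `n` vectors of dimension
`d = c ⌊log₂ n⌋` (`OVWithDim c`) has a deterministic `O(n^{2-ε})`-time word-RAM algorithm, then for
every width `k`, every density `c'` and every `δ > 1 - ε/2`, the `k`-CNFs with at most `c' · n`
clauses are decided on the deterministic word RAM in time `O(2^{δ n})`
(`SparseKSATInRAMTime k c' δ`). Printed form (R. Williams, TCS 348 (2005), §5.1, Theorem 5 of the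
author's version / Thm. 5.1: if cooperative subset queries over a `d`-element universe with `k`
sets per side are answered in `Õ(f(d) k^{2-ε})` time then CNF-SAT with `m` clauses and `n`
variables is in `Õ(f(m) 2^{(1-ε/2) n})`; VVW ICM 2018, §3, proof of Thm. 3.1): split the variables
into two halves, list the `N = 2^{⌈n/2⌉}` assignments of each half, give assignment `p` of the
first half the vector `u_p ∈ {0,1}^d` with `u_p[j] = 0` iff `p` already satisfies clause `j`
(makes one of its literals on a first-half variable true), and assignment `q` of the second half
the vector `v_q` with `v_q[j] = 0` iff `q` already satisfies clause `j` (padding coordinates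
`j ≥ m` are `0` on both sides), so that `⟨u_p, v_q⟩ = 0` iff the total assignment `(p, q)`
satisfies the formula; with `d = c ⌊log₂ N⌋ = c ⌈n/2⌉` for `c = 2c' + 2 ≥ 1` all `m ≤ c' n`
clauses fit, and one run of the OV algorithm for this `c` (at its own word size, emulated by
masking in relocated memory) decides the formula in
`O(N · d) + O(N^{2-ε}) = O(n 2^{n/2} + 2^{(1-ε/2)(n+1)}) = O(2^{δ n})` steps for every
`δ > 1 - ε/2 ≥ 1/2`. The hypothesis is used only on the diagonal `d = c log N` of Williams'
`f(d) · k^{2-ε}`, exactly as in the proof of VVW Thm. 3.1; `ε ≤ 1` because an `o(n · d)`-time bound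
cannot even read the instance and the construction alone costs `n · 2^{n/2}`. **Scope.** The
construction is width-independent and print covers CNF-SAT with `m ≤ c' n` clauses of any width
(a `CNFSATWithSize`-type conclusion); the statement here is its specialisation to the instances of
`kSATProblem k`, which is what the assembly `ovConjectureDet_of_sethWordRAM_of` consumes — a later
CNF-level word-RAM reading of §5.1 would be a strengthening, not a duplicate.
[cite: WilliamsTCS2005, §5.1 (Thm. 5.1; Theorem 5 of the author's version)]
[cite: VassilevskaWilliamsICM2018, §3 Thm. 3.1 (proof)]
[cite: VassilevskaWilliamsIPEC2015, §4 Thm. 1 (proof)] -/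
def sparseKSATInRAMTime_of_ov_subquadratic : Prop :=
  ∀ ε : ℝ, 0 < ε → ε ≤ 1 →
    (∀ c : ℕ, 1 ≤ c → (OVWithDim c).InTimeO fun n => (n : ℝ) ^ (2 - ε)) →
    ∀ (k c' : ℕ) (δ : ℝ), 1 - ε / 2 < δ → SparseKSATInRAMTime k c' δ

/-! ### Assembly -/

/-- `O(t)` time is `O(t')` time whenever `t ≤ t' + D` pointwise for a constant `D ≥ 0` (and both
bounds are nonnegative): the affine constant of `InTimeO` absorbs `D`. [folklore] -/
theorem inTimeO_of_le_add {P : FGProblem} {t t' : ℕ → ℝ} (h : P.InTimeO t) {D : ℝ} (hD : 0 ≤ D)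
    (ht : ∀ n, 0 ≤ t n) (ht' : ∀ n, 0 ≤ t' n) (htt' : ∀ n, t n ≤ t' n + D) : P.InTimeO t' := by
  obtain ⟨C, hC⟩ := h
  refine ⟨max C 0 * (1 + D), hC.mono fun n => ?_⟩
  have hM : 0 ≤ max C 0 := le_max_right _ _
  have h1 : C * t n ≤ max C 0 * t n := mul_le_mul_of_nonneg_right (le_max_left _ _) (ht n)
  have h2 : max C 0 * t n ≤ max C 0 * (t' n + D) := mul_le_mul_of_nonneg_left (htt' n) hM
  have h3 : max C 0 * t' n ≤ max C 0 * (1 + D) * t' n := by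
    have : max C 0 ≤ max C 0 * (1 + D) := le_mul_of_one_le_right hM (by linarith)
    exact mul_le_mul_of_nonneg_right this (ht' n)
  have h4 : C ≤ max C 0 := le_max_left _ _
  nlinarith [h1, h2, h3, h4, ht' n, hM, hD]

/-- Shrinking the saving: an `O(n^{2-ε})` algorithm is an `O(n^{2-ε'})` algorithm for `ε' ≤ ε`
(for `n ≥ 1` the bound grows; `n = 0` is absorbed by the affine constant). [folklore] -/
theorem inTimeO_rpow_two_sub_anti {P : FGProblem} {ε ε' : ℝ} (hε' : ε' ≤ ε)
    (h : P.InTimeO fun n => (n : ℝ) ^ (2 - ε)) : P.InTimeO fun n => (n : ℝ) ^ (2 - ε') := by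
  refine inTimeO_of_le_add h zero_le_one (fun n => Real.rpow_nonneg (Nat.cast_nonneg n) _)
    (fun n => Real.rpow_nonneg (Nat.cast_nonneg n) _) fun n => ?_
  rcases Nat.eq_zero_or_pos n with rfl | hn
  · have h0 : ((0 : ℕ) : ℝ) ^ (2 - ε) ≤ 1 := by
      rw [Nat.cast_zero]; exact Real.zero_rpow_le_one _
    have h0' : 0 ≤ ((0 : ℕ) : ℝ) ^ (2 - ε') := Real.rpow_nonneg (Nat.cast_nonneg 0) _
    linarith
  · have h1 : (1 : ℝ) ≤ (n : ℝ) := by exact_mod_cast hn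
    have := Real.rpow_le_rpow_of_exponent_le h1 (show 2 - ε ≤ 2 - ε' by linarith)
    linarith

/-- **Assembly of fine-grained.S09 in the word-RAM model (proved).** Sparsification as a SERF
reduction on the word RAM (`kSATInRAMTime_of_sparseKSATInRAMTime_serf`) and Williams' split-and-list
reduction (`sparseKSATInRAMTime_of_ov_subquadratic`) imply the printed theorem
`ovConjectureDet_of_sethWordRAM` (VVW ICM 2018, Thm. 3.1: word-RAM SETH implies the deterministic
OV conjecture) verbatim: if for some `ε > 0` OV had an `O(n^{2-ε})` algorithm in every dimension
`c log n`, shrink `ε` to `ε₁ = min ε 1`; sparse `k`-SAT of every density is then in time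
`O(2^{(1 - 3ε₁/8) n})`, so `k`-SAT is in time `O(2^{(1 - ε₁/4) n})` for *every* `k`, contradicting
`SETHWordRAM` at `ε₁/4`. [cite: VassilevskaWilliamsICM2018, §3 Thm. 3.1] -/
theorem ovConjectureDet_of_sethWordRAM_of (hsparse : kSATInRAMTime_of_sparseKSATInRAMTime_serf)
    (hsplit : sparseKSATInRAMTime_of_ov_subquadratic) : ovConjectureDet_of_sethWordRAM := by
  intro hSETH ε hε
  by_contra hno
  push Not at hno
  -- `hno : ∀ c, 1 ≤ c → (OVWithDim c).InTimeO fun n => n ^ (2 - ε)`; shrink `ε` below `1`.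
  set ε₁ : ℝ := min ε 1 with hε₁
  have hε₁pos : 0 < ε₁ := lt_min hε one_pos
  have hε₁le : ε₁ ≤ 1 := min_le_right _ _
  have hov : ∀ c : ℕ, 1 ≤ c → (OVWithDim c).InTimeO fun n => (n : ℝ) ^ (2 - ε₁) :=
    fun c hc => inTimeO_rpow_two_sub_anti (min_le_left _ _) (hno c hc)
  obtain ⟨k, -, hk⟩ := hSETH (ε₁ / 4) (by positivity)
  refine hk ?_
  obtain ⟨C, hC⟩ := hsparse k (ε₁ / 8) (by positivity)
  have hδ : 1 - ε₁ / 2 < 1 - ε₁ / 2 + ε₁ / 8 := by linarith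
  have hs : SparseKSATInRAMTime k C (1 - ε₁ / 2 + ε₁ / 8) :=
    hsplit ε₁ hε₁pos hε₁le hov k C _ hδ
  have hK := hC (1 - ε₁ / 2 + ε₁ / 8) (by linarith) hs
  have hexp : 1 - ε₁ / 2 + ε₁ / 8 + ε₁ / 8 = 1 - ε₁ / 4 := by ring
  rw [hexp] at hK
  exact hK

/-- The same assembly for the cross-model implication `SETH → OVConjectureDet`, given the
machine-model bridge (see `ovConjectureDet_of_seth_of_bridge`). [folklore] -/
theorem ovConjectureDet_of_seth_of (hbridge : SETH → SETHWordRAM)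
    (hsparse : kSATInRAMTime_of_sparseKSATInRAMTime_serf)
    (hsplit : sparseKSATInRAMTime_of_ov_subquadratic) : SETH → OVConjectureDet :=
  ovConjectureDet_of_seth_of_bridge hbridge (ovConjectureDet_of_sethWordRAM_of hsparse hsplit)

/-- The SETH-granularity sparsification fact gives back the ETH-granularity one of
`CliqueETH.lean` (take `ε = δ/2` and the density it provides). [folklore] -/
theorem kSATInRAMTime_of_sparseKSATInRAMTime_of_serf
    (h : kSATInRAMTime_of_sparseKSATInRAMTime_serf) : kSATInRAMTime_of_sparseKSATInRAMTime := by
  intro k hk δ hδ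
  obtain ⟨C, hC⟩ := h k (δ / 2) (by positivity)
  have := hC (δ / 2) (by positivity) (hk C (δ / 2) (by positivity))
  have hsum : δ / 2 + δ / 2 = δ := by ring
  rw [hsum] at this
  exact this

end Literature.Computability.FineGrained
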